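import Literature.LinearAlgebra.Matrix.PermanentHadamardCLL
import Literature.LinearAlgebra.Matrix.PermanentLaplace
import HarnessLib

/-!
# Proof of the Carlen–Lieb–Loss sub-permanent bound (CLL 2006, Theorem 3.1)

Discharges the named facts of `PermanentHadamardCLL.lean`:
`theorem carlenLiebLoss_subpermanent_le_holds` (Thm. 3.1) and, as its case `K = N` applied to the
transpose, `theorem carlenLiebLoss_permanent_le_holds` (Thm. 1.1; so `carlenLiebLoss_sq_rows`
of that file is now fed `carlenLiebLoss_permanent_le_holds`).

The proof is the printed *second proof* of

* E. Carlen, E. H. Lieb, M. Loss, *An inequality of Hadamard type for permanents*, Methods Appl.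
  Anal. 13 (2006) 1–18 = arXiv:math/0508096 [CarlenLiebLoss2006], §3, pp. 8–9 (Theorem 3.1):

induction on the number `K` of rows. For a `(k+1) × N` matrix `a` and a `(k+1)`-set `S` of
columns, expand `perm a_S` along the first row (`Matrix.permanent_eq_sum_row_zero` of
`PermanentLaplace.lean`): `perm a_S = ∑_{j ∈ S} a_{0,j} · perm g_{S∖j}` (`g` = the last `k` rows).
Squaring, the cross terms are bounded by the arithmetic–geometric mean inequality "in two
different ways" (p. 8) with the weights `α = (N-K)/N`, `1-α`; we package the two ways as the two
Cauchy–Schwarz inequalities `P² ≤ X·Y` and `P² ≤ K·D` (`cll_perS`). Summing over `S` and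
re-counting the pairs (`K`-set, element) as (`(K-1)`-set, non-element) (`cll_double_count`) gives
exactly the printed recursion (p. 9)
`𝒫(f_1,…,f_K)² ≤ K(N-K+1)/N · |f_1|² · 𝒫(f_2,…,f_K)²` (`cll_step`), whence
`𝒫_K² · N^K ≤ (N choose K)(K!)² ∏ |f_i|²` by induction (`cll_real`; the identity
`(N choose K)·K = (N choose K-1)·(N-K+1)` is `Nat.choose_succ_right_eq`). This real-entry
inequality needs no sign condition; the complex statement follows from `|perm F| ≤ perm |F|`
(p. 8, "we may assume that all entries of each vector are non negative").

## Design notes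

* Sibling "Proofs" file so that `PermanentHadamardCLL.lean` (the cited statements) stays as
  audited; everything here is a theorem.
* The `K`-subsets are summed over `{S : Finset (Fin N) // S.card = K}` exactly as in the
  statement; inside the proof they are moved to `Finset.powersetCard K univ` with the
  proof-dependent summand made total by a `dite` (`cll_sum_subtype_eq`).
-/

namespace Literature.LinearAlgebra.Matrix

open scoped BigOperators
open Finset

section CLL31

variable {N : ℕ}

/-- Sums over the subtype of `K`-subsets as sums over `powersetCard K univ`, the (proof-dependent)
summand being made total by a `dite`. [folklore] -/
private theorem cll_sum_subtype_eq (K : ℕ) (body : (S : Finset (Fin N)) → S.card = K → ℝ) :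
    ∑ S : {S : Finset (Fin N) // S.card = K}, body S.1 S.2 =
      ∑ S ∈ (univ : Finset (Fin N)).powersetCard K, (if h : S.card = K then body S h else 0) := by
  rw [sum_subtype ((univ : Finset (Fin N)).powersetCard K) (fun _ => mem_powersetCard_univ)
    (fun S => if h : S.card = K then body S h else 0)]
  exact Finset.sum_congr rfl fun S _ => (dif_pos S.2).symm

/-- Double counting of the pairs `(S, j)` with `j ∈ S`, `#S = k + 1` against the pairs `(U, j)`
with `j ∉ U`, `#U = k` (`U = S ∖ {j}`, `S = U ∪ {j}`). [folklore] -/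
private theorem cll_double_count (k : ℕ) (F : Fin N → Finset (Fin N) → ℝ) :
    ∑ S ∈ (univ : Finset (Fin N)).powersetCard (k + 1), ∑ j ∈ S, F j (S.erase j) =
      ∑ U ∈ (univ : Finset (Fin N)).powersetCard k, ∑ j ∈ Uᶜ, F j U := by
  rw [sum_sigma', sum_sigma']
  refine sum_bij' (fun x _ => ⟨x.1.erase x.2, x.2⟩) (fun y _ => ⟨insert y.2 y.1, y.2⟩)
    ?_ ?_ ?_ ?_ ?_
  · rintro ⟨S, j⟩ hx
    rw [mem_sigma, mem_powersetCard_univ] at hx ⊢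
    exact ⟨by rw [card_erase_of_mem hx.2, hx.1, Nat.add_sub_cancel],
      mem_compl.2 (notMem_erase j S)⟩
  · rintro ⟨U, j⟩ hy
    rw [mem_sigma, mem_powersetCard_univ] at hy ⊢
    exact ⟨by rw [card_insert_of_notMem (mem_compl.1 hy.2), hy.1], mem_insert_self j U⟩
  · rintro ⟨S, j⟩ hx
    rw [mem_sigma, mem_powersetCard_univ] at hx
    exact Sigma.ext (insert_erase hx.2) HEq.rfl
  · rintro ⟨U, j⟩ hy
    rw [mem_sigma, mem_powersetCard_univ] at hy
    exact Sigma.ext (erase_insert (mem_compl.1 hy.2)) HEq.rfl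
  · rintro ⟨S, j⟩ _
    rfl

/-- A sum over the increasing enumeration of `S` is the sum over `S`. [folklore] -/
private theorem cll_sum_orderEmbOfFin {k : ℕ} (S : Finset (Fin N)) (hS : S.card = k)
    (G : Fin N → ℝ) : ∑ m : Fin k, G (S.orderEmbOfFin hS m) = ∑ j ∈ S, G j := by
  rw [← sum_coe_sort S]
  exact Fintype.sum_equiv (S.orderIsoOfFin hS).toEquiv _ _ fun _ => rfl

/-- Deleting the `m`-th smallest element: the increasing enumeration of `S` composed with
`m.succAbove` is the increasing enumeration of `S ∖ {(S)_m}`. [folklore] -/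
private theorem cll_orderEmbOfFin_succAbove {k : ℕ} (S : Finset (Fin N)) (hS : S.card = k + 1)
    (m : Fin (k + 1)) (h' : (S.erase (S.orderEmbOfFin hS m)).card = k) :
    (fun i => S.orderEmbOfFin hS (m.succAbove i)) =
      fun i => (S.erase (S.orderEmbOfFin hS m)).orderEmbOfFin h' i := by
  have hfs : ∀ i, S.orderEmbOfFin hS (m.succAbove i) ∈ S.erase (S.orderEmbOfFin hS m) := fun i =>
    mem_erase.2 ⟨(S.orderEmbOfFin hS).injective.ne (Fin.succAbove_ne m i),
      orderEmbOfFin_mem S hS _⟩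
  exact orderEmbOfFin_unique h' hfs ((S.orderEmbOfFin hS).strictMono.comp
    (Fin.strictMono_succAbove m))

/-- **Per-subset bound** (CLL §3: Laplace expansion along the first row, then the two
AM–GM/Cauchy–Schwarz estimates of the cross terms with weights `(N-K)/N`, `K/N`).
[cite: CarlenLiebLoss2006, §3, proof of Thm. 3.1, p. 8] -/
private theorem cll_perS {k : ℕ} (hkN : k + 1 ≤ N) (a : _root_.Matrix (Fin (k + 1)) (Fin N) ℝ)
    (S : Finset (Fin N)) (hS : S.card = k + 1) (q : Finset (Fin N) → ℝ)
    (hq : ∀ m : Fin (k + 1),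
      (a.submatrix Fin.succ (fun i => S.orderEmbOfFin hS (m.succAbove i))).permanent =
        q (S.erase (S.orderEmbOfFin hS m))) :
    (N : ℝ) * (a.submatrix id (fun i => S.orderEmbOfFin hS i)).permanent ^ 2 ≤
      ((k : ℝ) + 1) * (((N : ℝ) - (k + 1)) * ∑ j ∈ S, a 0 j ^ 2 * q (S.erase j) ^ 2 +
        (∑ j ∈ S, a 0 j ^ 2) * ∑ j ∈ S, q (S.erase j) ^ 2) := by
  -- Laplace expansion along row `0`
  have hL : (a.submatrix id (fun i => S.orderEmbOfFin hS i)).permanent =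
      ∑ m : Fin (k + 1), a 0 (S.orderEmbOfFin hS m) * q (S.erase (S.orderEmbOfFin hS m)) := by
    rw [Matrix.permanent_eq_sum_row_zero]
    refine sum_congr rfl fun m _ => ?_
    rw [← hq m]
    rfl
  -- the two Cauchy–Schwarz inequalities
  have hCS1 := sum_mul_sq_le_sq_mul_sq univ (fun m => a 0 (S.orderEmbOfFin hS m))
    (fun m => q (S.erase (S.orderEmbOfFin hS m)))
  have hCS2 := sum_mul_sq_le_sq_mul_sq univ (fun _ => (1 : ℝ))
    (fun m => a 0 (S.orderEmbOfFin hS m) * q (S.erase (S.orderEmbOfFin hS m)))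
  simp only [one_mul, one_pow, sum_const, card_univ, Fintype.card_fin, nsmul_eq_mul,
    Nat.cast_add, Nat.cast_one, mul_one] at hCS2
  -- enumerated sums → sums over `S`
  rw [cll_sum_orderEmbOfFin S hS (fun j => a 0 j ^ 2),
    cll_sum_orderEmbOfFin S hS (fun j => q (S.erase j) ^ 2)] at hCS1
  have hD : ∑ m : Fin (k + 1), (a 0 (S.orderEmbOfFin hS m) * q (S.erase (S.orderEmbOfFin hS m))) ^ 2
      = ∑ j ∈ S, a 0 j ^ 2 * q (S.erase j) ^ 2 := by
    rw [← cll_sum_orderEmbOfFin S hS (fun j => a 0 j ^ 2 * q (S.erase j) ^ 2)]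
    exact sum_congr rfl fun m _ => mul_pow _ _ 2
  rw [hD] at hCS2
  rw [hL]
  have hNk : (0 : ℝ) ≤ (N : ℝ) - (k + 1) := by
    have : ((k + 1 : ℕ) : ℝ) ≤ N := by exact_mod_cast hkN
    push_cast at this
    linarith
  have hk0 : (0 : ℝ) ≤ (k : ℝ) + 1 := by positivity
  have h1 := mul_le_mul_of_nonneg_left hCS2 hNk
  have h2 := mul_le_mul_of_nonneg_left hCS1 hk0
  nlinarith [h1, h2]

/-- **The inductive step** of CLL Thm. 3.1 in squared form:
`N · 𝒫(a)² ≤ K (N - K + 1) · ‖a_0‖² · 𝒫(a_1, …, a_{K-1})²` (`K = k + 1`; real entries, no sign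
condition needed). [cite: CarlenLiebLoss2006, §3, proof of Thm. 3.1, p. 9] -/
private theorem cll_step {k : ℕ} (hkN : k + 1 ≤ N) (a : _root_.Matrix (Fin (k + 1)) (Fin N) ℝ) :
    (N : ℝ) * ∑ S : {S : Finset (Fin N) // S.card = k + 1},
        (a.submatrix id (fun i => S.1.orderEmbOfFin S.2 i)).permanent ^ 2 ≤
      ((k : ℝ) + 1) * ((N : ℝ) - k) * (∑ j, a 0 j ^ 2) *
        ∑ U : {U : Finset (Fin N) // U.card = k},
          ((a.submatrix Fin.succ id).submatrix id (fun i => U.1.orderEmbOfFin U.2 i)).permanent ^ 2 := by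
  -- the `k × k` minors of the last `k` rows, as a total function of the column set
  obtain ⟨q, hq⟩ : ∃ q : Finset (Fin N) → ℝ, ∀ (U : Finset (Fin N)) (h : U.card = k),
      q U = ((a.submatrix Fin.succ id).submatrix id (fun i => U.orderEmbOfFin h i)).permanent :=
    ⟨fun U => if h : U.card = k then
        ((a.submatrix Fin.succ id).submatrix id (fun i => U.orderEmbOfFin h i)).permanent else 0,
      fun U h => dif_pos h⟩
  have hTk : (∑ U : {U : Finset (Fin N) // U.card = k},
      ((a.submatrix Fin.succ id).submatrix id (fun i => U.1.orderEmbOfFin U.2 i)).permanent ^ 2) =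
      ∑ U ∈ (univ : Finset (Fin N)).powersetCard k, q U ^ 2 := by
    have h1 := cll_sum_subtype_eq k (fun U h =>
      ((a.submatrix Fin.succ id).submatrix id (fun i => U.orderEmbOfFin h i)).permanent ^ 2)
    beta_reduce at h1
    rw [h1]
    refine sum_congr rfl fun U hU => ?_
    rw [mem_powersetCard_univ] at hU
    rw [dif_pos hU, hq U hU]
  have hTk1 : (∑ S : {S : Finset (Fin N) // S.card = k + 1},
      (a.submatrix id (fun i => S.1.orderEmbOfFin S.2 i)).permanent ^ 2) =
      ∑ S ∈ (univ : Finset (Fin N)).powersetCard (k + 1),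
        (if h : S.card = k + 1 then
          (a.submatrix id (fun i => S.orderEmbOfFin h i)).permanent ^ 2 else 0) := by
    have h1 := cll_sum_subtype_eq (k + 1) (fun S h =>
      (a.submatrix id (fun i => S.orderEmbOfFin h i)).permanent ^ 2)
    beta_reduce at h1
    exact h1
  rw [hTk1, hTk, mul_sum]
  -- per-subset bound
  have hper : ∀ S ∈ (univ : Finset (Fin N)).powersetCard (k + 1),
      (N : ℝ) * (if h : S.card = k + 1 then
          (a.submatrix id (fun i => S.orderEmbOfFin h i)).permanent ^ 2 else 0) ≤
      ((k : ℝ) + 1) * (((N : ℝ) - (k + 1)) * ∑ j ∈ S, a 0 j ^ 2 * q (S.erase j) ^ 2 +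
        (∑ j ∈ S, a 0 j ^ 2) * ∑ j ∈ S, q (S.erase j) ^ 2) := by
    intro S hS
    rw [mem_powersetCard_univ] at hS
    rw [dif_pos hS]
    refine cll_perS hkN a S hS q fun m => ?_
    have h' : (S.erase (S.orderEmbOfFin hS m)).card = k := by
      rw [card_erase_of_mem (orderEmbOfFin_mem S hS m), hS, Nat.add_sub_cancel]
    rw [hq _ h']
    show (a.submatrix Fin.succ (fun i => S.orderEmbOfFin hS (m.succAbove i))).permanent =
      (a.submatrix Fin.succ (fun i => (S.erase (S.orderEmbOfFin hS m)).orderEmbOfFin h' i)).permanent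
    rw [cll_orderEmbOfFin_succAbove S hS m h']
  refine (sum_le_sum hper).trans (le_of_eq ?_)
  -- collecting terms (double counting twice)
  have hD : ∑ S ∈ (univ : Finset (Fin N)).powersetCard (k + 1),
      ∑ j ∈ S, a 0 j ^ 2 * q (S.erase j) ^ 2 =
      ∑ U ∈ (univ : Finset (Fin N)).powersetCard k, (∑ j ∈ Uᶜ, a 0 j ^ 2) * q U ^ 2 := by
    rw [cll_double_count k (fun j U => a 0 j ^ 2 * q U ^ 2)]
    exact sum_congr rfl fun U _ => by rw [sum_mul]
  have hXY : ∑ S ∈ (univ : Finset (Fin N)).powersetCard (k + 1),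
      (∑ j ∈ S, a 0 j ^ 2) * ∑ j ∈ S, q (S.erase j) ^ 2 =
      ∑ U ∈ (univ : Finset (Fin N)).powersetCard k,
        ((∑ j ∈ Uᶜ, a 0 j ^ 2) + ((N : ℝ) - k) * ∑ j ∈ U, a 0 j ^ 2) * q U ^ 2 := by
    have h1 : ∀ S ∈ (univ : Finset (Fin N)).powersetCard (k + 1),
        (∑ j ∈ S, a 0 j ^ 2) * ∑ j ∈ S, q (S.erase j) ^ 2 =
        ∑ j ∈ S, (a 0 j ^ 2 + ∑ i ∈ S.erase j, a 0 i ^ 2) * q (S.erase j) ^ 2 := by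
      intro S _
      rw [mul_sum]
      refine sum_congr rfl fun j hj => ?_
      rw [add_sum_erase S (fun i => a 0 i ^ 2) hj]
    rw [sum_congr rfl h1, cll_double_count k (fun j U => (a 0 j ^ 2 + ∑ i ∈ U, a 0 i ^ 2) * q U ^ 2)]
    refine sum_congr rfl fun U hU => ?_
    rw [mem_powersetCard_univ] at hU
    rw [← sum_mul, sum_add_distrib, sum_const, card_compl, hU, Fintype.card_fin, nsmul_eq_mul,
      Nat.cast_sub (by omega)]
  have hfin : ((N : ℝ) - (k + 1)) *
        ∑ U ∈ (univ : Finset (Fin N)).powersetCard k, (∑ j ∈ Uᶜ, a 0 j ^ 2) * q U ^ 2 +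
      ∑ U ∈ (univ : Finset (Fin N)).powersetCard k,
        ((∑ j ∈ Uᶜ, a 0 j ^ 2) + ((N : ℝ) - k) * ∑ j ∈ U, a 0 j ^ 2) * q U ^ 2 =
      ((N : ℝ) - k) * (∑ j, a 0 j ^ 2) *
        ∑ U ∈ (univ : Finset (Fin N)).powersetCard k, q U ^ 2 := by
    rw [mul_sum, mul_sum, ← sum_add_distrib]
    refine sum_congr rfl fun U _ => ?_
    rw [← sum_compl_add_sum U fun j => a 0 j ^ 2]
    ring
  rw [← mul_sum, sum_add_distrib, ← mul_sum, hD, hXY, hfin]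
  ring

/-- **CLL Thm. 3.1, squared and cleared of denominators, for real matrices:**
`𝒫(a)² · N^K ≤ (N choose K) (K!)² ∏_i ‖a_i‖²`. Induction on `K` by `cll_step`.
[cite: CarlenLiebLoss2006, Thm. 3.1] -/
private theorem cll_real : ∀ (K N : ℕ) (a : _root_.Matrix (Fin K) (Fin N) ℝ), K ≤ N →
    (∑ S : {S : Finset (Fin N) // S.card = K},
        (a.submatrix id (fun i => S.1.orderEmbOfFin S.2 i)).permanent ^ 2) * (N : ℝ) ^ K ≤
      (N.choose K : ℝ) * (K.factorial : ℝ) ^ 2 * ∏ i, ∑ j, a i j ^ 2 := by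
  intro K
  induction K with
  | zero =>
    intro N a _
    simp [Matrix.permanent_isEmpty]
  | succ k ih =>
    intro N a hk
    have hstep := cll_step hk a
    have ih' := ih N (a.submatrix Fin.succ id) (by omega)
    have hPi : (∏ i : Fin k, ∑ j, (a.submatrix Fin.succ id) i j ^ 2) =
        ∏ i : Fin k, ∑ j, a i.succ j ^ 2 := rfl
    rw [hPi] at ih'
    rw [Fin.prod_univ_succ]
    set T1 := ∑ S : {S : Finset (Fin N) // S.card = k + 1},
        (a.submatrix id (fun i => S.1.orderEmbOfFin S.2 i)).permanent ^ 2 with hT1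
    set T0 := ∑ U : {U : Finset (Fin N) // U.card = k},
        ((a.submatrix Fin.succ id).submatrix id
          (fun i => U.1.orderEmbOfFin U.2 i)).permanent ^ 2 with hT0
    set A := ∑ j, a 0 j ^ 2 with hA
    set P := ∏ i : Fin k, ∑ j, a i.succ j ^ 2 with hP
    have hnat : ((k : ℝ) + 1) * ((N : ℝ) - k) * (N.choose k : ℝ) * (k.factorial : ℝ) ^ 2 =
        (N.choose (k + 1) : ℝ) * ((k + 1).factorial : ℝ) ^ 2 := by
      have h1 : N.choose (k + 1) * (k + 1).factorial ^ 2 =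
          (k + 1) * (N - k) * N.choose k * k.factorial ^ 2 := by
        have h2 := Nat.choose_succ_right_eq N k
        calc N.choose (k + 1) * (k + 1).factorial ^ 2
            = (N.choose (k + 1) * (k + 1)) * ((k + 1) * k.factorial ^ 2) := by
              rw [Nat.factorial_succ]; ring
          _ = (N.choose k * (N - k)) * ((k + 1) * k.factorial ^ 2) := by rw [h2]
          _ = (k + 1) * (N - k) * N.choose k * k.factorial ^ 2 := by ring
      have h3 : ((N - k : ℕ) : ℝ) = (N : ℝ) - k := Nat.cast_sub (by omega)
      rw [← h3]
      exact_mod_cast h1.symm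
    have hN0 : (0 : ℝ) ≤ (N : ℝ) ^ k := by positivity
    have hA0 : (0 : ℝ) ≤ A := sum_nonneg fun j _ => sq_nonneg _
    have hNk : (0 : ℝ) ≤ (N : ℝ) - k := by
      have : (k : ℝ) ≤ N := by exact_mod_cast (show k ≤ N by omega)
      linarith
    have hc0 : (0 : ℝ) ≤ ((k : ℝ) + 1) * ((N : ℝ) - k) * A :=
      mul_nonneg (mul_nonneg (by positivity) hNk) hA0
    calc T1 * (N : ℝ) ^ (k + 1) = ((N : ℝ) * T1) * (N : ℝ) ^ k := by ring
      _ ≤ (((k : ℝ) + 1) * ((N : ℝ) - k) * A * T0) * (N : ℝ) ^ k :=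
          mul_le_mul_of_nonneg_right hstep hN0
      _ = (((k : ℝ) + 1) * ((N : ℝ) - k) * A) * (T0 * (N : ℝ) ^ k) := by ring
      _ ≤ (((k : ℝ) + 1) * ((N : ℝ) - k) * A) *
            ((N.choose k : ℝ) * (k.factorial : ℝ) ^ 2 * P) :=
          mul_le_mul_of_nonneg_left ih' hc0
      _ = (N.choose (k + 1) : ℝ) * ((k + 1).factorial : ℝ) ^ 2 * (A * P) := by
          rw [← hnat]; ring

/-- **Carlen–Lieb–Loss 2006, Theorem 3.1 — proved.** Discharge of the named fact
`carlenLiebLoss_subpermanent_le`, following the printed induction on `K` (CLL §3, pp. 8–9):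
reduce to the entrywise moduli (`|perm F| ≤ perm |F|`), expand each `K × K` column-minor along
its first row, bound the cross terms by the arithmetic–geometric mean inequality in the two ways
of the paper (packaged here as the two Cauchy–Schwarz inequalities `P² ≤ XY`, `P² ≤ K·D`, with
the paper's weights `(N-K)/N` and `K/N`), and collect by double counting the pairs
(`K`-set, element) — this is `cll_step`, the recursion `𝒫_K² ≤ K(N-K+1)/N · |f_1|² · 𝒫_{K-1}²`
of p. 9 — then induct (`cll_real`). [cite: CarlenLiebLoss2006, Thm. 3.1 and its proof, §3] -/
theorem carlenLiebLoss_subpermanent_le_holds : carlenLiebLoss_subpermanent_le := by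
  intro K N f hKN
  -- entrywise moduli
  set a : _root_.Matrix (Fin K) (Fin N) ℝ := fun i j => ‖f i j‖ with ha
  have hreal := cll_real K N a hKN
  have hpt : ∀ S : {S : Finset (Fin N) // S.card = K},
      ‖(f.submatrix id (fun k => (S.1.orderEmbOfFin S.2 k : Fin N))).permanent‖ ^ 2 ≤
        (a.submatrix id (fun i => S.1.orderEmbOfFin S.2 i)).permanent ^ 2 := by
    intro S
    refine pow_le_pow_left₀ (norm_nonneg _) ?_ 2
    unfold Matrix.permanent
    refine (norm_sum_le _ _).trans (le_of_eq (sum_congr rfl fun σ _ => ?_))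
    rw [norm_prod]
    rfl
  have hsum : (∑ S : {S : Finset (Fin N) // S.card = K},
      ‖(f.submatrix id (fun k => (S.1.orderEmbOfFin S.2 k : Fin N))).permanent‖ ^ 2) ≤
      ∑ S : {S : Finset (Fin N) // S.card = K},
        (a.submatrix id (fun i => S.1.orderEmbOfFin S.2 i)).permanent ^ 2 :=
    sum_le_sum fun S _ => hpt S
  have hNK : (0 : ℝ) < (N : ℝ) ^ K := by
    rcases Nat.eq_zero_or_pos N with hN | hN
    · subst hN
      obtain rfl : K = 0 := by omega
      simp
    · positivity
  have hB0 : 0 ≤ Real.sqrt (N.choose K : ℝ) * ((K.factorial : ℝ) / Real.sqrt ((N : ℝ) ^ K)) *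
      ∏ i, Real.sqrt (∑ j, ‖f i j‖ ^ 2) := by positivity
  have hBsq : (Real.sqrt (N.choose K : ℝ) * ((K.factorial : ℝ) / Real.sqrt ((N : ℝ) ^ K)) *
      ∏ i, Real.sqrt (∑ j, ‖f i j‖ ^ 2)) ^ 2 =
      (N.choose K : ℝ) * (K.factorial : ℝ) ^ 2 * (∏ i, ∑ j, ‖f i j‖ ^ 2) / (N : ℝ) ^ K := by
    rw [mul_pow, mul_pow, div_pow, Real.sq_sqrt (Nat.cast_nonneg _), Real.sq_sqrt hNK.le,
      ← prod_pow, prod_congr rfl fun i _ => Real.sq_sqrt (sum_nonneg fun j _ => sq_nonneg _)]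
    ring
  refine Real.sqrt_le_iff.2 ⟨hB0, ?_⟩
  rw [hBsq, le_div_iff₀ hNK]
  exact (mul_le_mul_of_nonneg_right hsum hNK.le).trans hreal

/-- **Carlen–Lieb–Loss 2006, Theorem 1.1 — proved** as the case `K = N` of Theorem 3.1 applied to
the transpose (p. 8: "Because of (3.2), Theorem 3.1 reduces to Theorem 1.1 in the case `K = N`"):
the only `N`-set of columns is `univ`, whose increasing enumeration is the identity
(`Finset.orderEmbOfFin_unique`), `(N choose N) = 1`, and `perm Fᵀ = perm F`
(`Matrix.permanent_transpose`) turns the row norms of `Fᵀ` into the column norms of `F`.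
[cite: CarlenLiebLoss2006, Thm. 1.1 and (3.2)] -/
theorem carlenLiebLoss_permanent_le_holds : carlenLiebLoss_permanent_le := by
  intro N F
  have hU : (univ : Finset (Fin N)).card = N := by rw [card_univ, Fintype.card_fin]
  haveI : Subsingleton {S : Finset (Fin N) // S.card = N} :=
    ⟨fun S T => Subtype.ext ((S.1.eq_univ_of_card (by rw [S.2, Fintype.card_fin])).trans
      (T.1.eq_univ_of_card (by rw [T.2, Fintype.card_fin])).symm)⟩
  -- the increasing enumeration of `univ` is the identity
  have hid : (fun k => ((univ : Finset (Fin N)).orderEmbOfFin hU k : Fin N)) = id :=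
    (orderEmbOfFin_unique hU (f := id) (fun _ => mem_univ _) strictMono_id).symm
  have hlhs : Real.sqrt (∑ S : {S : Finset (Fin N) // S.card = N},
      ‖(F.transpose.submatrix id (fun k => (S.1.orderEmbOfFin S.2 k : Fin N))).permanent‖ ^ 2) =
      ‖F.permanent‖ := by
    rw [Fintype.sum_subsingleton _ ⟨univ, hU⟩]
    show Real.sqrt (‖(F.transpose.submatrix id
      (fun k => ((univ : Finset (Fin N)).orderEmbOfFin hU k : Fin N))).permanent‖ ^ 2) = _
    rw [hid, Matrix.submatrix_id_id, Matrix.permanent_transpose, Real.sqrt_sq (norm_nonneg _)]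
  have h := carlenLiebLoss_subpermanent_le_holds N N F.transpose le_rfl
  rw [hlhs, Nat.choose_self, Nat.cast_one, Real.sqrt_one, one_mul] at h
  simpa only [Matrix.transpose_apply] using h

end CLL31

end Literature.LinearAlgebra.Matrix
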